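import Summits.BirchSwinnertonDyer.BirchSwinnertonDyer.Theorems.GenusKolyvaginAtTwoHalfTransverseLocalDefs
import Summits.BirchSwinnertonDyer.BirchSwinnertonDyer.Theorems.GenusKolyvaginAtTwoPowDvdShaCardAtTwoRTHalfTransverseIsotropicPackaged
import HarnessLib

/-!
# Route `GenusKolyvaginAtTwo`, crux L_T `PowDvdShaCardAtTwoRT` (stmt-BirchSwinnertonDyer-23242), LINE 18 stub L, bottom rung
# (index-`≥ 2` engine): THE DEEP-OWN-PRIME INPUT, PACKAGED — a local Frobenius lift `g₀`, `index (halfTransverseLocal g₀) ≤ 2`, and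
# the vanishing of the own-prime term `inv_ℓ(loc (2^{M−1}•Z) ∪ loc y)` for `loc_ℓ y ∈ halfTransverseLocal g₀`

Seat `bsd-line-gk2-p3` g21 (PROVER seat 3/3, cell `bsd-f1-sign2`), `--supports 23242 --as helper`.  THEOREMS ONLY; no `sorry`.  Assembles
this seat's `…HalfTransverseLocalDefs` (M_ℓ, index, bridge), `…RTHalfTransverseIsotropic(Packaged)` (I7½) at a Gross–Kolyvagin prime on
`Δ < 0` (`FrobEqFrobInfty`, `exists_regular_generator_of_Δ_neg`), in the shape the LEAD's engine (memo g16 §2/§8) consumes: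
* **`exists_localFrob_index_halfTransverseLocal_le_two`** — at the place `v` of an odd good Gross–Kolyvagin prime of depth `M ≥ 1` there is
  `g₀ ∈ Γ_{ℚ_v}` whose restriction `F = res g₀` is an arithmetic Frobenius at the prime `𝔓 = ι₀⁻¹𝔐` of the chosen embedding, acting on
  `E[2^M]` as a complex conjugation `c₀`, and **`(halfTransverseLocal W (2^M) ℚ_v g₀).index ≤ 2`** — the hypothesis of
  `exists_mem_kummerOutside_four_localization_mem_two_nsmul_ne_zero_of_index_le_two` (p701532) at the deep own primes (`M = 2`).
* **`inv_cupProduct_localization_nsmul_eq_zero_of_localization_mem_halfTransverseLocal`** — for such `g₀, F`: if `x` is half-transverse at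
  `F` (`[x,F] ∈ (F−1)T + 2T`, the engine's `Z`, input (iii)) and `loc_v y ∈ halfTransverseLocal … g₀` (the engine's auxiliary, by
  construction), then `inv_v (loc_v (2^{M−1}•x) ∪ₑ loc_v y) = 0` — the own-prime term at `ℓ ∈ t` of `sum_inv_weilCupProduct_localization_eq_zero`.
HONEST FRAMING: packaging only; closes nothing.  BSD is NOT proved by any of this.

References: [McCallumLMS1991] §5 Lemma 5.3 and proof of Prop. 5.2; [GrossLMS1991] §3 (3.2)–(3.3); [NeukirchANT1999] Ch. II §9 (9.6).
-/

set_option autoImplicit false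
set_option linter.dupNamespace false -- tree convention: `Summit.BirchSwinnertonDyer.BirchSwinnertonDyer.Theorems` (summit = sub-problem)

noncomputable section
open scoped Classical Pointwise

namespace Summit.BirchSwinnertonDyer.BirchSwinnertonDyer.Theorems.GenusExact.TransverseIsotropy

open WeierstrassCurve NumberField IsDedekindDomain Field
open Literature.NumberTheory.EllipticCurves Literature.NumberTheory.GaloisRepresentations
open Literature.NumberTheory.GaloisCohomology
open Summit.BirchSwinnertonDyer.BirchSwinnertonDyer.Theorems.GenusExact.FrobeniusCriterion

variable {v : HeightOneSpectrum (𝓞 ℚ)} (W : WeierstrassCurve ℚ) [W.IsElliptic]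

/-- **A local Frobenius lift with an index-`≤ 2` half-transverse condition, at a Gross–Kolyvagin prime on `Δ < 0`.**  `E = W/ℚ` with
`Δ < 0`, `M ≥ 1`, `ℓ` an odd prime at the good place `v` with `Frob(ℓ) = Frob(∞)` on `ℚ(E[2^M])` (`FrobEqFrobInfty W K (2^M) ℓ`), `𝔐` a
prime of `\bar ℤ_{ℚ_v}`.  Then there are `g₀ ∈ Γ_{ℚ_v}`, `F, c₀ ∈ Γ_ℚ` with `res g₀ = F`, `F` an arithmetic Frobenius at `𝔓 = ι₀⁻¹𝔐`, `c₀`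
a complex conjugation, `F = c₀` on `E[2^M]`, and **`index (halfTransverseLocal W (2^M) ℚ_v g₀) ≤ 2`** (`E[2^M]` is free of rank one over
`ℤ/2^M[c₀]`, `exists_regular_generator_of_Δ_neg`; `(F−1)T + 2T` has index `2`). [cite: McCallumLMS1991, §5 Lemma 5.3] [cite: GrossLMS1991, §3 (3.2)–(3.3)] -/
theorem exists_localFrob_index_halfTransverseLocal_le_two (hΔ : W.Δ < 0) {M : ℕ} (hM : 1 ≤ M)
    {ℓ : ℕ} (hℓ : ℓ.Prime) (hℓv : (ℓ : 𝓞 ℚ) ∈ v.asIdeal)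
    {K : Type} [Field K] [NumberField K] (hℓM : FrobEqFrobInfty W K (2 ^ M) ℓ)
    {𝔐 : Ideal (HeightOneSpectrum.localAbsIntegers v)} (h𝔐 : 𝔐 ∈ v.localPrimesAbove) :
    ∃ (g₀ : absoluteGaloisGroup (v.adicCompletion ℚ)) (F c₀ : absoluteGaloisGroup ℚ),
      absGaloisRestrict ℚ (v.adicCompletion ℚ) g₀ = F ∧
      IsArithFrobAt (𝓞 ℚ) F (v.primeBelow (closureEmb (K := ℚ) (v.adicCompletion ℚ)) 𝔐) ∧
      IsComplexConjugation (Rat.castHom ℝ) c₀ ∧ (∀ P : geomTorsion W ((2 ^ M : ℕ) : ℤ), F • P = c₀ • P) ∧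
      (halfTransverseLocal W ((2 ^ M : ℕ) : ℤ) (v.adicCompletion ℚ) g₀).index ≤ 2 := by
  set 𝔓 := v.primeBelow (closureEmb (K := ℚ) (v.adicCompletion ℚ)) 𝔐 with h𝔓def
  have h𝔓 : 𝔓 ∈ v.primesAbove := HeightOneSpectrum.primeBelow_mem_primesAbove h𝔐
  haveI : 𝔓.IsPrime := h𝔓.1
  obtain ⟨F, c₀, hFrob, hc₀, hE, -⟩ := FrobEqFrobInfty.exists_at (W := W) (K := K) hℓ hℓM hℓv h𝔓
  obtain ⟨g₀, hg₀⟩ := exists_absGaloisRestrict_eq_of_isArithFrobAt (K := ℚ) h𝔐 hFrob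
  obtain ⟨P, hPM, hgen, hfree⟩ := exists_regular_generator_of_Δ_neg W hΔ hc₀ hM
  refine ⟨g₀, F, c₀, hg₀, hFrob, hc₀, hE, ?_⟩
  have hgenF : ∀ Q : geomTorsion W ((2 ^ M : ℕ) : ℤ), ∃ x y : ℤ, Q = x • P + y • absGaloisRestrict ℚ (v.adicCompletion ℚ) g₀ • P := by
    intro Q; rw [hg₀, hE P]; exact hgen Q
  have hfreeF : ∀ x y : ℤ, x • P + y • absGaloisRestrict ℚ (v.adicCompletion ℚ) g₀ • P = 0 →
      ((2 ^ M : ℕ) : ℤ) ∣ x ∧ ((2 ^ M : ℕ) : ℤ) ∣ y := by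
    intro x y h; rw [hg₀, hE P] at h; exact_mod_cast hfree x y h
  have hF : ∀ Q : geomTorsion W ((2 ^ M : ℕ) : ℤ),
      absGaloisRestrict ℚ (v.adicCompletion ℚ) g₀ • absGaloisRestrict ℚ (v.adicCompletion ℚ) g₀ • Q = Q := fun Q ↦ by
    rw [hg₀, hE, hE, ← mul_smul, ← pow_two, hc₀.sq_eq_one, one_smul]
  have hq : (2 : ℤ) ∣ ((2 ^ M : ℕ) : ℤ) := by
    obtain ⟨M', rfl⟩ : ∃ M', M = M' + 1 := ⟨M - 1, by omega⟩
    exact ⟨2 ^ M', by push_cast; ring⟩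
  exact index_halfTransverseLocal_le_two W ((2 ^ M : ℕ) : ℤ) (v.adicCompletion ℚ) g₀ hq hF hgenF hfreeF

/-- **The own-prime term vanishes for the engine's pair**: same setting; `g₀, F, c₀` as produced above (any `g₀` with `res g₀ = F`, `F` an
arithmetic Frobenius at `𝔓` acting on `E[2^M]` as the complex conjugation `c₀`); `e` an alternating biadditive `Γ_ℚ`-equivariant
`μ_{2^M}`-valued pairing; `x` HALF-TRANSVERSE at `F` (`∃ P₁ Q₁, [x,F] = (FP₁ − P₁) + 2Q₁` — the engine's `Z = desc c₂(nℓ′)`, input (iii))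
and `y` with **`loc_v y ∈ halfTransverseLocal W (2^M) ℚ_v g₀`** (the engine's auxiliary class, by construction of the count).  Then
**`inv_v (loc_v (2^{M−1}•x) ∪ₑ loc_v y) = 0`** for every family of local invariant maps — the term at a deep own prime `ℓ ∈ t` of
`sum_inv_weilCupProduct_localization_eq_zero` for `(X, y)`, `X = 2^{M−1}•Z` (`M = 2`: `X = 2Z`).
[cite: McCallumLMS1991, §5 proof of Prop. 5.2 (13)] [cite: GrossLMS1991, §3 (3.3)] -/
theorem inv_cupProduct_localization_nsmul_eq_zero_of_localization_mem_halfTransverseLocal (hΔ : W.Δ < 0) {M : ℕ} (hM : 1 ≤ M)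
    {ℓ : ℕ} (hℓ : ℓ.Prime) (hℓ2 : ℓ ≠ 2) (hℓv : (ℓ : 𝓞 ℚ) ∈ v.asIdeal) (hgood : W.HasGoodReductionAt v)
    {𝔐 : Ideal (HeightOneSpectrum.localAbsIntegers v)} (h𝔐 : 𝔐 ∈ v.localPrimesAbove)
    {g₀ : absoluteGaloisGroup (v.adicCompletion ℚ)} {F c₀ : absoluteGaloisGroup ℚ}
    (hg₀ : absGaloisRestrict ℚ (v.adicCompletion ℚ) g₀ = F)
    (hFrob : IsArithFrobAt (𝓞 ℚ) F (v.primeBelow (closureEmb (K := ℚ) (v.adicCompletion ℚ)) 𝔐))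
    (hc₀ : IsComplexConjugation (Rat.castHom ℝ) c₀) (hE : ∀ P : geomTorsion W ((2 ^ M : ℕ) : ℤ), F • P = c₀ • P)
    (e : geomTorsion W (2 ^ M : ℕ) → geomTorsion W (2 ^ M : ℕ) → AlgebraicClosure ℚ)
    (hμ : ∀ S T, e S T ^ (2 ^ M) = 1) (hadd₁ : ∀ S₁ S₂ T, e (S₁ + S₂) T = e S₁ T * e S₂ T)
    (hadd₂ : ∀ S T₁ T₂, e S (T₁ + T₂) = e S T₁ * e S T₂) (halt : ∀ T, e T T = 1)
    (hgal : ∀ (σ : absoluteGaloisGroup ℚ) (S T : geomTorsion W (2 ^ M : ℕ)), σ • e S T = e (σ • S) (σ • T))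
    (inv : LocalInvariants ℚ (2 ^ M))
    {x y : galH1Torsion W ((2 ^ M : ℕ) : ℤ)}
    (hx : ∃ P₁ Q₁ : geomTorsion W ((2 ^ M : ℕ) : ℤ), h1Eval W _ x F = (F • P₁ - P₁) + (2 : ℕ) • Q₁)
    (hy : galoisCohomology.localization (W.torsionGaloisModule ((2 ^ M : ℕ) : ℤ)) (Sum.inr v) 1 y ∈
      halfTransverseLocal W ((2 ^ M : ℕ) : ℤ) (v.adicCompletion ℚ) g₀) :
    haveI := absoluteGaloisGroup_compactSpace (Place.Completion (Sum.inr v : Place ℚ))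
    inv (Sum.inr v) ((weilContPairingLocal W (2 ^ M) e hμ hadd₁ hadd₂ hgal (Sum.inr v)).cupProduct
      (galoisCohomology.localization (W.torsionGaloisModule ((2 ^ M : ℕ) : ℤ)) (Sum.inr v) 1 ((2 ^ (M - 1) : ℕ) • x))
      (galoisCohomology.localization (W.torsionGaloisModule ((2 ^ M : ℕ) : ℤ)) (Sum.inr v) 1 y)) = 0 := by
  haveI := absoluteGaloisGroup_compactSpace (Place.Completion (Sum.inr v : Place ℚ))
  -- `2, q ∉ v`; regular generator; hypotheses of I7½ §3
  have h2v : ((2 : ℕ) : 𝓞 ℚ) ∉ v.asIdeal := two_notMem_of_odd_prime_mem hℓ hℓ2 hℓv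
  have hqv' : ((2 ^ M : ℕ) : 𝓞 ℚ) ∉ v.asIdeal := by
    rw [Nat.cast_pow]
    exact fun h ↦ h2v (v.isPrime.mem_of_pow_mem M h)
  have hqv : ((((2 ^ M : ℕ) : ℤ)) : 𝓞 ℚ) ∉ v.asIdeal := by rwa [Int.cast_natCast]
  have hq0 : (2 ^ M : ℕ) ≠ 0 := pow_ne_zero M two_ne_zero
  have hq0Z : ((2 ^ M : ℕ) : ℤ) ≠ 0 := by exact_mod_cast hq0
  have hwbad : v ∉ W.badPlaces (𝓞 ℚ) := fun h ↦ h hgood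
  set 𝔓 := v.primeBelow (closureEmb (K := ℚ) (v.adicCompletion ℚ)) 𝔐 with h𝔓def
  have h𝔓 : 𝔓 ∈ v.primesAbove := HeightOneSpectrum.primeBelow_mem_primesAbove h𝔐
  haveI : 𝔓.IsPrime := h𝔓.1
  obtain ⟨P, hPM, hgen, hfree⟩ := exists_regular_generator_of_Δ_neg W hΔ hc₀ hM
  have hgenF : ∀ Q : geomTorsion W ((2 ^ M : ℕ) : ℤ), ∃ x y : ℤ, Q = x • P + y • F • P := by
    intro Q; rw [hE P]; exact hgen Q
  have hfreeF : ∀ x y : ℤ, x • P + y • F • P = 0 → ((2 ^ M : ℕ) : ℤ) ∣ x ∧ ((2 ^ M : ℕ) : ℤ) ∣ y := by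
    intro x y h; rw [hE P] at h; exact_mod_cast hfree x y h
  have hPq : ((2 ^ M : ℕ) : ℤ) • P = 0 := by exact_mod_cast hPM
  have hF : ∀ Q : geomTorsion W ((2 ^ M : ℕ) : ℤ), F • F • Q = Q := fun Q ↦ by
    rw [hE, hE, ← mul_smul, ← pow_two, hc₀.sq_eq_one, one_smul]
  have hI : 𝔓.inertia (absoluteGaloisGroup ℚ) ≤ torsionFixing W ((2 ^ M : ℕ) : ℤ) :=
    inertia_le_torsionFixing W hwbad hqv _ h𝔐
  have hopen := isOpen_torsionFixing W hq0Z
  have hFμ : ∀ ζ : AlgebraicClosure ℚ, ζ ^ (2 ^ M) = 1 → F • ζ = ζ⁻¹ := fun ζ hζ ↦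
    smul_eq_inv_of_smul_torsion_pow_eq W Nat.prime_two hM rfl hc₀ hE hζ
  -- `y` is half-transverse at `F = res g₀` (bridge)
  have hy' : ∃ P₂ Q₂ : geomTorsion W ((2 ^ M : ℕ) : ℤ), h1Eval W _ y F = (F • P₂ - P₂) + (2 : ℕ) • Q₂ := by
    obtain ⟨a, b, hab⟩ := (localization_mem_halfTransverseLocal_iff W ((2 ^ M : ℕ) : ℤ) g₀ y).mp hy
    refine ⟨a, b, ?_⟩
    have hres : resGal (K := ℚ) (v.adicCompletion ℚ) g₀ = F := hg₀
    rw [hres, ofNat_zsmul] at hab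
    exact hab
  have h := nsmul_cupProduct_localization_eq_zero_of_halfTransverse W Nat.prime_two rfl hM hqv' h𝔐 hFrob hFμ hF hPq hgenF
    hfreeF hI hopen e hμ hadd₁ hadd₂ halt hgal hx hy'
  have h' : (weilContPairingLocal W (2 ^ M) e hμ hadd₁ hadd₂ hgal (Sum.inr v)).cupProduct
      (galoisCohomology.localization (W.torsionGaloisModule ((2 ^ M : ℕ) : ℤ)) (Sum.inr v) 1 ((2 ^ (M - 1) : ℕ) • x))
      (galoisCohomology.localization (W.torsionGaloisModule ((2 ^ M : ℕ) : ℤ)) (Sum.inr v) 1 y) = 0 := by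
    rw [show galoisCohomology.localization (W.torsionGaloisModule ((2 ^ M : ℕ) : ℤ)) (Sum.inr v) 1 ((2 ^ (M - 1) : ℕ) • x) =
        (2 ^ (M - 1) : ℕ) • galoisCohomology.localization (W.torsionGaloisModule ((2 ^ M : ℕ) : ℤ)) (Sum.inr v) 1 x from
      map_nsmul _ _ _]
    erw [map_nsmul, LinearMap.smul_apply]
    exact h
  rw [h']
  exact map_zero _

end Summit.BirchSwinnertonDyer.BirchSwinnertonDyer.Theorems.GenusExact.TransverseIsotropy

end
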